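import Mathlib
import Literature.MathematicalPhysics.QuantumFieldTheory.Balaban1983to89.B6Ineq283

/-!
# `Balaban1983to89.B6Expansion282` — the decomposition (2.82), p. 237, Q′G′²Q′*C = I − R as a kernel-checked
identity in any ring of operators (from □h_□ = h_□, Σ_□ h_□² = 1 (2.36) and the defining property of C_□ (2.70)), the
operators R_{□,□′} read off its lines, the fixed-point form and Neumann truncation behind (2.86); and THE COMMUTATOR
LINE of (2.82) — p. 238, *"An estimate of the terms with the commutator is even simpler and gives a factor O(M⁻¹)"* —
typed on the multiscale carrier `B6.Geometry` with the pairing (2.69) and proved with its exact mechanism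
((h_□(y) − h_□(y″)) costs (s/M)·d(y, y″); d e^{−bδ₀d} ≤ 1/(e bδ₀)), together with a witness on which the factor M⁻¹ is
attained (B6 = T. Bałaban, *Propagators and renormalization transformations for lattice gauge theories. II*, Commun.
Math. Phys. **96**, 223–250 (1984) [Balaban1984PropagatorsII]).

CITATION HEADER (lean-in-tree rule 2026-08-18).  Cell `pub-balaban`, unit `b2b-balaban-b06-g10` (paper sub-cell B06,
gen 10 — the owner lineage of `…B6`, `…B6RandomWalk`, `…B6Ineq268`, `…B6Ineq283`, `…B6DomainTerm282`,
`…B6DomainMajorant`, `…B6DomainMajorantSandwich`).  Source: doi:10.1007/bf01240221, held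
`paper:balaban1984-cmp96-propagators-rt-ii`; journal page = PDF page + 222; the quotations below were read from the
page renders `b2b-balaban-ref1/pages/1984-cmp96-propagators-rt-II/1984-cmp96-propagators-rt-II-p007-x2.png` (p. 229),
`…-p013-x2.png` (p. 235), `…-p015-x2.png` (p. 237) and `…-p016-x2.png` (p. 238) AS IMAGES.  Kernel twin of the hand
certification GAPS C-adv4-40 (unit b2b-balaban-adv4-g14: hostile second reading of (2.82)–(2.87), incl. its script
`check282.py` for the algebra of (2.82) and its prose for the commutator terms); sibling of `…B6Ineq283` (the example
family □ ≠ □′ of (2.83)) and `…B6DomainTerm282` / `…B6DomainMajorant[Sandwich]` (the family with G′(□̃)² − G′²); cell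
rows GAPS C-b06g10-1, DIVERGENCE D-b06.22; journal claim LINE282-2-COMMUTATOR.

THE PRINTED TEXT.  p. 229 [PDF 7], on the partition of unity: *"We construct also the corresponding family of
functions h described in (1.118), and rescale them to proper scales. They satisfy Σ_{□∈𝒟} h_□² = 1. (2.36)"*.
p. 235 [PDF 13], verbatim: *"⟨λ, λ′⟩ = Σ_{j=0}^k Σ_{y∈Λ_j} (L^jη)^d λ(y)λ′(y). (2.69)"* … *"The approximate inverse can be
constructed by taking inverses of the localized operators (Q′G′²Q′*)↾_□ and glueing them together by the
decomposition of unity {h_□}. We change this prescription a little bit; we take a second cube □̃ containing □ in the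
middle and of the size 4M and we take an inverse of the operator (Q′G′(□̃)²Q′*)↾_□ instead of (Q′G′²Q′*)↾_□. Let us
define C_□ = ((Q′G′(□̃)²Q′*)↾_□)⁻¹, C = Σ_{□∈𝒟} h_□C_□h_□. (2.70) At first let us find bounds on C_□. We assume that
either □̃ ⊂ B^j(Λ_j), or it intersects B^{j+1}(Λ_{j+1}) also."*  p. 237 [PDF 15], verbatim: *"Of course we have also a
bound from above and an exponential decay of the kernel of Q′G′^ξ(□̃)²Q′* with the decay rate δ₀."* …
*"|C_□(y, y′)| ≤ O(1)(L^jη)^{−d−4} e^{−δ₁(L^jη)^{−1}|y−y′|}, y, y′ ∈ 𝔅∩□. (2.81) Now we will proceed in the same way as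
in Sect. 5, (5.12)–(5.17) [3]. We will show that Q′G′²Q′*C is a good approximation of identity. We have
Q′G′²Q′*C = Σ_{□∈𝒟} Q′G′²Q′*h_□C_□h_□ = Σ_□ h_□(□Q′G′(□̃)²Q′*□)C_□h_□ − Σ_□ [h_□, □Q′G′(□̃)²Q′*□]C_□h_□
− Σ_□ □Q′(G′(□̃)² − G′²)Q′*h_□C_□h_□ − Σ_{□,□′≠□} (□ − 1)h²_{□′}Q′G′²Q′*h_□C_□h_□ = I − Σ_{□,□′} R_{□,□′}C_{□′}h_{□′}
= I − R, (2.82) with an obvious definition of the operators R_{□,□′}. We have to estimate the norm of R in the space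
L²(𝔅). For example let us consider the operator R_{□,□′}C_{□′}h_{□′} with □ ≠ □′. A kernel of this operator can be
estimated as follows |(□′ − 1)(y)h²_□(y) Σ_{y″∈supp h_{□′}} (L^{j′}η)^d(Q′G′²Q′*)(y, y″)h_{□′}(y″)C_{□′}(y″, y′)h_{□′}(y′)|
≤ …"* [(2.83), typed in `…B6Ineq283`].  p. 238 [PDF 16], verbatim: *"so for M large enough the norm is small. Similar
inequalities hold for kernels of the other operators forming R, for example the operator with G′(□̃)² − G′² is small
and an estimate has the factor e^{−δ₀M} because of the usual estimate of the type (1.12) [3] connected with a change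
of a domain. This estimate follows from the random walk representations (2.50) for the operators G′, G′(□̃). An
estimate of the terms with the commutator is even simpler and gives a factor O(M⁻¹). Now we can estimate the norm of
R either using the estimates of the type (2.84), or using an estimate of the kernel R(y, y′) of the operator R
following from all the partial estimates of the type (2.83). It can be written as
|R(y, y′)| ≤ O(M⁻¹)e^{−δ₁d(y,y′)}(L^{j′}η)^{−d}, y, y′ ∈ 𝔅, y′ ∈ Λ_{j′}, (2.85) and by Lemma 2.1 we get Proposition 2.3. An
inverse of the operator Q′G′²Q′* is given by the convergent expansion (Q′G′²Q′*)⁻¹ = C(I − R)⁻¹ = Σ_{n=0}^∞ CRⁿ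
= Σ_ω h_{□₀}C_{□₀}h_{□₀}R_{□₁,□₂}C_{□₂}h_{□₂}·…·R_{□_{2n−1},□_{2n}}C_{□_{2n}}h_{□_{2n}}, (2.86)"*; and, same page (Sect. C):
*"Let us take a cube □ connected with a L^jη-scale, i.e. either □ ⊂ B^j(Λ_j), or it intersects also B^{j+1}(Λ_{j+1})."*

THE TYPING.  §1 is stated in an arbitrary ring A (the ring of linear operators on functions on 𝔅): the cubes □ ∈ 𝒟
are a finite index type D; `p □` = multiplication by the characteristic function □, `h □` = multiplication by h_□,
`x` = X = Q′G′²Q′*, `t □` = X̃_□ = Q′G′(□̃)²Q′*, `locOp p t □` = □X̃_□□, `c □` = C_□; the three printed inputs are the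
hypotheses □h_□ = h_□ (supp h_□ ⊂ □), `PartitionSq h` = (2.36), and (□X̃_□□)C_□h_□ = h_□ (C_□ inverts the localized
operator on functions supported in □, (2.70)).  `R282` is the sum of lines 2–4 of (2.82) verbatim and `Rpair □ □′`
the operators R_{□,□′} (□′ = the cube carrying C_{□′}h_{□′}): R_{□,□} = [h_□, □X̃_□□] + □(X̃_□ − X)h_□, and for
□ ≠ □′ R_{□,□′} = (□′ − 1)h_□²Xh_{□′} — the reading under which the print's example kernel (2.83) is literally the
kernel of R_{□,□′}C_{□′}h_{□′}.  §2 realises the ring as `Module.End ℝ (𝔅 → ℝ)` over a finite site type: `mulOp h`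
(multiplication), `kerOp w X` (the operator with kernel X in the pairing (2.69), w(y″) = (L^{j″}η)^d), and computes the
kernel `line2Ker w h X C` of ONE TERM [h_□, X_□]C_□h_□ of line 2 (`line2_operator_eq`).  §3 is stated over the abstract
multiscale carrier `g : B6.Geometry` of `…B6` with the tree predicates (2.54) = `B6RandomWalk.Triangle254` and (2.61)
in the generic-constant form `B6Lemma21Repaired.Ineq261With c g δ₀ σ`; S′ ⊂ 𝔅 is the finite set off which
C_□(·, y′) vanishes (𝔅 ∩ □); ρ(y″) stands for the printed (L^jη)^{−1}|y″ − y′| of (2.81), entering only through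
d(y″, y′) ≤ ρ(y″) on S′ (the straight contour inside □ is admissible in (2.46)) — exactly as in `…B6Ineq283`; the
M-dependence enters ONLY through the hypothesis |h(y) − h(y″)| ≤ (s/M)·d(y, y″) with a free constant s.  §4 is the
concrete face geometry `B6Ineq283.faceGeo m m L R m` (m + 1 collinear support points at mutual distances |t − s|; an
isometric copy of a configuration in (ℝ², ℓ^∞), one scale) with M = m, the ramp h(p_t) = 1 − t/m, X = the admitted
majorant itself and C = the identity kernel.

WHAT THIS MODULE PROVES (kernel-checked; no `sorry`, no axiom beyond Lean's three; every hypothesis is a tree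
predicate of Lemma 2.1 / (2.54), one of the three printed algebraic inputs, or an explicit majorant with free
constants):
1. `per_cube`, `expansion282` — (2.82): X·C = 1 − R in ANY ring from □h_□ = h_□, Σ_□ h_□² = 1 and (□X̃_□□)C_□h_□ = h_□
   (the one-family special case with □ = 1, X̃ = X is (1.122) of [B5], `B5Local114.deltaA_mul_C0`); `R282_eq_pairSum` —
   R = Σ_{□,□′} R_{□,□′}C_{□′}h_{□′} with the R_{□,□′} above (*"with an obvious definition of the operators R_{□,□′}"*
   made explicit); `inverse_fixedPoint`, `neumann_truncation` — a left inverse G of X satisfies G = C + GR, hence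
   G = Σ_{n<N} CRⁿ + GR^N for every N: the algebraic skeleton of (2.86) (convergence is NOT treated here).
2. `comm_mulOp_kerOp`, `kerOp_mul_kerOp`, `kerOp_mul_mulOp`, `mulOp_mul_kerOp`, `mulOp_mul_mulOp`, `partitionSq_mulOp`,
   `line2_operator_eq` — the dictionary ring ↔ kernels in the pairing (2.69): [h, X] has kernel (h(y) − h(y″))X(y, y″),
   (2.36) pointwise gives `PartitionSq` for the multiplication operators, and [h_□, X_□]C_□h_□ is the kernel operator of
   `line2Ker`.
3. `line2Ker_abs_le` — THE COMMUTATOR SENTENCE, one term, as a kernel bound: if |w(y″)X(y, y″)| ≤ A_X e^{−aδ₀d(y,y″)},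
   |C(y″, y′)| ≤ A_C e^{−δ₁ρ(y″)} on S′ (zero off S′) with d(y″, y′) ≤ ρ(y″), |h(y) − h(y″)| ≤ (s/M)d(y, y″), |h(y′)| ≤ 1,
   then for every split δ₁ + σδ₀ + bδ₀ ≤ aδ₀ (b > 0) and (2.61) at rate σ with constant c:
   |([h_□, X_□]C_□h_□)(y, y′)| ≤ (s/M)·(A_X A_C c/(e·bδ₀))·e^{−δ₁d(y,y′)} — *"even simpler"* made literal: no gap
   «y ∉ □̃′», no (2.60), no threshold on RM is used (contrast members 3–5 of (2.83) in `…B6Ineq283`); the whole factor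
   M⁻¹ comes from the Lipschitz bound of h_□, paid for by the rate bδ₀ through `mul_exp_neg_le` (t e^{−βt} ≤ 1/(eβ)).
   `len_pow_four_le`, `line2Ker_abs_le_285` — the (2.85) reading: with A_X = B_X(L^jη)⁴ (the powers of (2.68), weight
   included) and A_C = B_C(L^{j′}η)^{−4}·P(y′) ((2.81), P(y′) = (L^{j′}η)^{−d}), and j ≤ j′ + 1 inside one cube (p. 235,
   p. 238), the bound is M⁻¹·(s B_X B_C L⁴ c/(e·bδ₀))·e^{−δ₁d(y,y′)}·P(y′), i.e. the shape (2.85) with an O(·)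
   independent of M, j, η, k.
4. `commutator_factor_attained`, `ramp_bound_and_value`, `ramp_constant_lower` — SHARPNESS IN M: on the ramp witness
   all hypotheses of 3 hold with the M-independent data (s, A_X, A_C, c) = (1, 1, 1, 2 + c₀(σ)) (`faceGeo_ineq261With`),
   and |([h, X]Ch)(p₁, p₀)| = e^{−aδ₀}·M⁻¹ exactly; consequently any bound (κ/M)e^{−δ₁d(y,y′)} valid on the witnesses has
   κ ≥ e^{δ₁−aδ₀} uniformly in M: the printed O(M⁻¹) is the true order of the commutator terms, not an artefact.
WHAT IT DOES NOT PROVE: the kernel majorants themselves (the p. 237 bound for Q′G′(□̃)²Q′* *"with the decay rate δ₀"*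
in an admissible choice of powers — hypothesis `hX`; (2.81) — hypothesis `hC`); the admissibility of the straight
contour (hypothesis `hρ`); THE LIPSCHITZ BOUND OF h_□ WITH RESPECT TO M·d (hypothesis `hLip`, constant s): from
(1.118) [B5] rescaled (|∂h_□| ≤ O(1)(ML^jη)^{−1} for a cube connected with the L^jη-scale) and (2.46) one gets s = O(1)
when the minimising contours between points of □ stay in B^j(Λ_j), but only s = O(L) when □ *"intersects also
B^{j+1}(Λ_{j+1})"* (portions there are measured in the unit L^{j+1}η) — so on such cubes the printed O(M⁻¹) reads
O(L·M⁻¹) unless the construction of {h_□} adapts the scale; this is LOCATED (GAPS C-b06g10-1 (r1)), not adjudicated,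
and s is free in every theorem here; the other two families of R ((2.83): `…B6Ineq283`; G′(□̃)² − G′²:
`…B6DomainTerm282`, `…B6DomainMajorant`, `…B6DomainMajorantSandwich`); the passage from kernel bounds to the norm bounds
(2.84)/(2.85) ⇒ ‖R‖ small and the convergence of (2.86)–(2.87) (C-adv4-40; `…B6Cor28`, `…QGQInverse`).
Value = kernel certificate of the printed algebra of (2.82) and of the located sentence on the commutator terms with
its exact mechanism and its sharpness in M, NOT summit progress.
-/

namespace Literature.MathematicalPhysics.QuantumFieldTheory.Balaban1983to89.B6Expansion282

open Literature.MathematicalPhysics.QuantumFieldTheory.Balaban1983to89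
open Finset

/-! ## §1. (2.82) as an identity in a ring of operators -/

section Identity282

variable {A : Type*} [Ring A] {D : Type*} [Fintype D] [DecidableEq D]

/-- The commutator [a, b] = ab − ba. [folklore] -/
def comm (a b : A) : A := a * b - b * a

/-- The localized operator □Q′G′(□̃)²Q′*□ of (2.82): `locOp p t □ = p □ * t □ * p □` (p □ = multiplication by the
characteristic function of □, t □ = Q′G′(□̃)²Q′*). [cite: Balaban1984PropagatorsII, (2.82) p.237] -/
def locOp (p t : D → A) (i : D) : A := p i * t i * p i

/-- The glued approximate inverse C = Σ_{□∈𝒟} h_□ C_□ h_□ of (2.70). [cite: Balaban1984PropagatorsII, (2.70) p.235] -/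
def Cglued (h c : D → A) : A := ∑ i, h i * c i * h i

/-- R of (2.82), READ OFF ITS LINES 2–4 verbatim: Σ_□ [h_□, □X̃_□□]C_□h_□ + Σ_□ □(X̃_□ − X)h_□C_□h_□
+ Σ_{□, □′≠□} (□ − 1)h²_{□′} X h_□C_□h_□ (X = Q′G′²Q′* = `x`, X̃_□ = Q′G′(□̃)²Q′* = `t □`).
[cite: Balaban1984PropagatorsII, (2.82) p.237] -/
def R282 (x : A) (p t h c : D → A) : A :=
  ∑ i, (comm (h i) (locOp p t i) * c i * h i + p i * (t i - x) * h i * c i * h i +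
    ∑ i' ∈ univ.erase i, (p i - 1) * (h i' * h i') * x * h i * c i * h i)

/-- The operators R_{□,□′} of *"with an obvious definition of the operators R_{□,□′}"* (□′ = the cube carrying
C_{□′}h_{□′}): R_{□,□} = [h_□, □X̃_□□] + □(X̃_□ − X)h_□ and, for □ ≠ □′, R_{□,□′} = (□′ − 1)h_□² X h_{□′} (the example
term of (2.83)). OURS (the reading of the printed lines). [cite: Balaban1984PropagatorsII, (2.82)–(2.83) p.237] -/
def Rpair (x : A) (p t h : D → A) (i i' : D) : A :=
  if i = i' then comm (h i) (locOp p t i) + p i * (t i - x) * h i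
  else (p i' - 1) * (h i * h i) * x * h i'

omit [DecidableEq D] in
/-- Σ_{□} h_□² = 1 as a statement about the family (2.36). (abbreviation) [cite: Balaban1984PropagatorsII, (2.36) p.229] -/
def PartitionSq (h : D → A) : Prop := ∑ i, h i * h i = 1

/-- **One cube of (2.82).**  For every □: X h_□C_□h_□ = h_□(□X̃_□□)C_□h_□ − [h_□, □X̃_□□]C_□h_□ − □(X̃_□ − X)h_□C_□h_□
− Σ_{□′≠□}(□ − 1)h²_{□′}X h_□C_□h_□, using only □h_□ = h_□ and Σ_{□′} h²_{□′} = 1. [cite: Balaban1984PropagatorsII, (2.82) p.237] -/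
theorem per_cube (x : A) {p t h : D → A} (c : D → A) (hph : ∀ i, p i * h i = h i) (h236 : PartitionSq h)
    (i : D) :
    x * (h i * c i * h i) =
      h i * locOp p t i * c i * h i - comm (h i) (locOp p t i) * c i * h i
        - p i * (t i - x) * h i * c i * h i
        - ∑ i' ∈ univ.erase i, (p i - 1) * (h i' * h i') * x * h i * c i * h i := by
  -- the off-diagonal line: Σ_{□′≠□} h²_{□′} = 1 − h²_□, and (□ − 1)(1 − h_□²) = □ − 1
  have hsq : ∑ i' ∈ univ.erase i, h i' * h i' = 1 - h i * h i := by
    rw [Finset.sum_erase_eq_sub (Finset.mem_univ i), h236]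
  have hline4 : ∑ i' ∈ univ.erase i, (p i - 1) * (h i' * h i') * x * h i * c i * h i =
      (p i - 1) * x * h i * c i * h i := by
    have : ∑ i' ∈ univ.erase i, (p i - 1) * (h i' * h i') * x * h i * c i * h i =
        (p i - 1) * (∑ i' ∈ univ.erase i, h i' * h i') * (x * h i * c i * h i) := by
      rw [Finset.mul_sum, Finset.sum_mul]
      refine Finset.sum_congr rfl fun i' _ => ?_
      simp only [mul_assoc]
    rw [this, hsq]
    have hphh : p i * (h i * h i) = h i * h i := by rw [← mul_assoc, hph]
    have : (p i - 1) * (1 - h i * h i) = p i - 1 := by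
      rw [mul_sub, mul_one, sub_mul, one_mul, hphh]; abel
    rw [this]; simp only [mul_assoc]
  rw [hline4]
  have hph' : ∀ r : A, p i * (h i * r) = h i * r := fun r => by rw [← mul_assoc, hph]
  simp only [comm, locOp, mul_sub, sub_mul, one_mul, mul_assoc, hph']
  abel

/-- **(2.82)** (p. 237), verbatim: *"Q′G′²Q′*C = Σ_{□∈𝒟} Q′G′²Q′*h_□C_□h_□ = Σ_□ h_□(□Q′G′(□̃)²Q′*□)C_□h_□
− Σ_□ [h_□, □Q′G′(□̃)²Q′*□]C_□h_□ − Σ_□ □Q′(G′(□̃)² − G′²)Q′*h_□C_□h_□ − Σ_{□,□′≠□} (□ − 1)h²_{□′}Q′G′²Q′*h_□C_□h_□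
= I − Σ_{□,□′} R_{□,□′}C_{□′}h_{□′} = I − R, (2.82)"* — as an identity in any ring, from (2.36) Σ_□ h_□² = 1,
supp h_□ ⊂ □ (□h_□ = h_□) and the defining property (2.70) of C_□ = ((Q′G′(□̃)²Q′*)↾_□)⁻¹ in the form
(□X̃_□□)C_□h_□ = h_□. [cite: Balaban1984PropagatorsII, (2.82) p.237] -/
theorem expansion282 (x : A) {p t h c : D → A} (hph : ∀ i, p i * h i = h i) (h236 : PartitionSq h)
    (h270 : ∀ i, locOp p t i * c i * h i = h i) :
    x * Cglued h c = 1 - R282 x p t h c := by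
  unfold Cglued R282
  rw [Finset.mul_sum]
  have key : ∀ i, x * (h i * c i * h i) = h i * h i - (comm (h i) (locOp p t i) * c i * h i +
      p i * (t i - x) * h i * c i * h i +
      ∑ i' ∈ univ.erase i, (p i - 1) * (h i' * h i') * x * h i * c i * h i) := by
    intro i
    rw [per_cube x c hph h236 i]
    have h1 : h i * locOp p t i * c i * h i = h i * h i := by
      rw [mul_assoc (h i), mul_assoc (h i), h270]
    rw [h1]; abel
  simp_rw [key]
  rw [Finset.sum_sub_distrib, h236]

/-- The last equality of (2.82): R = Σ_{□,□′} R_{□,□′}C_{□′}h_{□′} with the R_{□,□′} of `Rpair`.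
[cite: Balaban1984PropagatorsII, (2.82) p.237] -/
theorem R282_eq_pairSum (x : A) (p t h c : D → A) :
    R282 x p t h c = ∑ i, ∑ i', Rpair x p t h i i' * c i' * h i' := by
  rw [Finset.sum_comm]
  unfold R282
  refine Finset.sum_congr rfl fun i' _ => ?_
  rw [← Finset.add_sum_erase _ _ (Finset.mem_univ i')]
  have hdiag : Rpair x p t h i' i' * c i' * h i' =
      comm (h i') (locOp p t i') * c i' * h i' + p i' * (t i' - x) * h i' * c i' * h i' := by
    simp only [Rpair, if_true, add_mul]
  have hoff : ∑ i ∈ univ.erase i', Rpair x p t h i i' * c i' * h i' =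
      ∑ i ∈ univ.erase i', (p i' - 1) * (h i * h i) * x * h i' * c i' * h i' := by
    refine Finset.sum_congr rfl fun i hi => ?_
    rw [Rpair, if_neg (Finset.ne_of_mem_erase hi)]
  rw [hdiag, hoff]

/-- (2.86), algebra: if GX = I (G = (Q′G′²Q′*)⁻¹) then XC = I − R gives the fixed point G = C + GR.
[cite: Balaban1984PropagatorsII, (2.86) p.238] -/
theorem inverse_fixedPoint {x g : A} {p t h c : D → A} (hgx : g * x = 1) (hph : ∀ i, p i * h i = h i)
    (h236 : PartitionSq h) (h270 : ∀ i, locOp p t i * c i * h i = h i) :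
    g = Cglued h c + g * R282 x p t h c := by
  have e := expansion282 x hph h236 h270
  have : g * (x * Cglued h c) = g * (1 - R282 x p t h c) := by rw [e]
  rw [← mul_assoc, hgx, one_mul, mul_sub, mul_one] at this
  rw [this, sub_add_cancel]

omit [Fintype D] [DecidableEq D] in
/-- (2.86), the finite truncation of *"(Q′G′²Q′*)⁻¹ = C(I − R)⁻¹ = Σ_{n=0}^∞ CRⁿ"*: G = Σ_{n<N} CRⁿ + GR^N for every N
(convergence is (2.85) + Lemma 2.1, not typed here). [cite: Balaban1984PropagatorsII, (2.86) p.238] -/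
theorem neumann_truncation {g C R : A} (hfix : g = C + g * R) (N : ℕ) :
    g = ∑ n ∈ Finset.range N, C * R ^ n + g * R ^ N := by
  induction N with
  | zero => simp
  | succ N ih =>
    calc g = ∑ n ∈ Finset.range N, C * R ^ n + g * R ^ N := ih
      _ = ∑ n ∈ Finset.range N, C * R ^ n + (C + g * R) * R ^ N := by rw [← hfix]
      _ = _ := by rw [add_mul, mul_assoc, ← pow_succ', Finset.sum_range_succ, add_assoc]

end Identity282

/-! ## §2. Multiplication and kernel operators on 𝔅 in the pairing (2.69); the commutator kernel -/

section Kernels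

variable {S : Type*} [Fintype S]

/-- Multiplication operator (h·μ)(y) = h(y)μ(y) on functions 𝔅 → ℝ (h_□, the characteristic function □).
[cite: Balaban1984PropagatorsII, (2.70)/(2.82) pp.235–237] -/
def mulOp (h : S → ℝ) : Module.End ℝ (S → ℝ) where
  toFun μ := fun y => h y * μ y
  map_add' μ ν := by funext y; simp only [Pi.add_apply]; ring
  map_smul' r μ := by funext y; simp only [Pi.smul_apply, smul_eq_mul, RingHom.id_apply]; ring

/-- Kernel operator in the scalar product (2.69) ⟨λ, λ′⟩ = Σ_j Σ_{y∈Λ_j} (L^jη)^d λ(y)λ′(y): (K_w X μ)(y) =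
Σ_{y″∈𝔅} w(y″) X(y, y″) μ(y″), w(y″) = (L^{j″}η)^d the weight of the site y″. [cite: Balaban1984PropagatorsII, (2.69) p.235] -/
def kerOp (w : S → ℝ) (X : S → S → ℝ) : Module.End ℝ (S → ℝ) where
  toFun μ := fun y => ∑ y'', w y'' * X y y'' * μ y''
  map_add' μ ν := by
    funext y; simp only [Pi.add_apply, mul_add, Finset.sum_add_distrib]
  map_smul' r μ := by
    funext y; simp only [Pi.smul_apply, smul_eq_mul, RingHom.id_apply, Finset.mul_sum]
    refine Finset.sum_congr rfl fun _ _ => by ring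

/-- The kernel of the commutator [h, X] of a multiplication operator with a kernel operator:
([h, X])(y, y″) = (h(y) − h(y″)) X(y, y″). [folklore] -/
def commKer (h : S → ℝ) (X : S → S → ℝ) : S → S → ℝ := fun y y'' => (h y - h y'') * X y y''

/-- The kernel of a product of kernel operators in the pairing (2.69): (X₁X₂)(y, y′) = Σ_{y″} w(y″)X₁(y,y″)X₂(y″,y′).
[folklore] -/
def compKer (w : S → ℝ) (X₁ X₂ : S → S → ℝ) : S → S → ℝ := fun y y' => ∑ y'', w y'' * X₁ y y'' * X₂ y'' y'

/-- The kernel of ONE TERM OF LINE 2 of (2.82), [h_□, X_□]C_□h_□ (X_□ = □Q′G′(□̃)²Q′*□):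
(y, y′) ↦ (Σ_{y″} w(y″)(h(y) − h(y″))X(y,y″)C(y″,y′))·h(y′). [cite: Balaban1984PropagatorsII, (2.82) line 2 p.237] -/
def line2Ker (w h : S → ℝ) (X C : S → S → ℝ) : S → S → ℝ := fun y y' => compKer w (commKer h X) C y y' * h y'

omit [Fintype S] in
/-- (h·μ)(y) = h(y)μ(y). [folklore] -/
@[simp] theorem mulOp_apply (h μ : S → ℝ) (y : S) : mulOp h μ y = h y * μ y := rfl

/-- (K_w X μ)(y) = Σ_{y″} w(y″)X(y, y″)μ(y″). [folklore] -/
@[simp] theorem kerOp_apply (w : S → ℝ) (X : S → S → ℝ) (μ : S → ℝ) (y : S) :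
    kerOp w X μ y = ∑ y'', w y'' * X y y'' * μ y'' := rfl

/-- [h, X] is the kernel operator with kernel (h(y) − h(y″))X(y,y″) — the bridge between §1's ring commutator (in the
ring of linear operators on 𝔅 → ℝ) and the kernel estimated in §3. [folklore] -/
theorem comm_mulOp_kerOp (w h : S → ℝ) (X : S → S → ℝ) :
    comm (mulOp h) (kerOp w X) = kerOp w (commKer h X) := by
  refine LinearMap.ext fun μ => funext fun y => ?_
  simp only [comm, LinearMap.sub_apply, Module.End.mul_apply, kerOp_apply, mulOp_apply, commKer, Pi.sub_apply,
    Finset.mul_sum, ← Finset.sum_sub_distrib]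
  refine Finset.sum_congr rfl fun _ _ => by ring

/-- Composition of kernel operators = kernel operator of the composed kernel. [folklore] -/
theorem kerOp_mul_kerOp (w : S → ℝ) (X₁ X₂ : S → S → ℝ) :
    kerOp w X₁ * kerOp w X₂ = kerOp w (compKer w X₁ X₂) := by
  refine LinearMap.ext fun μ => funext fun y => ?_
  simp only [Module.End.mul_apply, kerOp_apply, compKer, Finset.mul_sum, Finset.sum_mul]
  rw [Finset.sum_comm]
  refine Finset.sum_congr rfl fun _ _ => Finset.sum_congr rfl fun _ _ => by ring

/-- Kernel operator followed by a multiplication operator on the right: kernel X(y,y″)h(y″). [folklore] -/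
theorem kerOp_mul_mulOp (w h : S → ℝ) (X : S → S → ℝ) :
    kerOp w X * mulOp h = kerOp w (fun y y'' => X y y'' * h y'') := by
  refine LinearMap.ext fun μ => funext fun y => ?_
  simp only [Module.End.mul_apply, kerOp_apply, mulOp_apply]
  refine Finset.sum_congr rfl fun _ _ => by ring

/-- Multiplication operator on the left: kernel h(y)X(y,y″) (so □X̃□ has kernel □(y)X̃(y,y″)□(y″)). [folklore] -/
theorem mulOp_mul_kerOp (w h : S → ℝ) (X : S → S → ℝ) :
    mulOp h * kerOp w X = kerOp w (fun y y'' => h y * X y y'') := by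
  refine LinearMap.ext fun μ => funext fun y => ?_
  simp only [Module.End.mul_apply, kerOp_apply, mulOp_apply, Finset.mul_sum]
  refine Finset.sum_congr rfl fun _ _ => by ring

omit [Fintype S] in
/-- Products of multiplication operators (□h_□ = h_□ when supp h_□ ⊂ □, h_□h_□ = h_□²). [folklore] -/
theorem mulOp_mul_mulOp (h₁ h₂ : S → ℝ) : mulOp h₁ * mulOp h₂ = mulOp (fun y => h₁ y * h₂ y) := by
  refine LinearMap.ext fun μ => funext fun y => ?_
  simp only [Module.End.mul_apply, mulOp_apply, mul_assoc]

omit [Fintype S] in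
/-- (2.36) in operator form: Σ_□ h_□h_□ = 1 when Σ_□ h_□(y)² = 1 pointwise — the hypothesis `PartitionSq` of §1 for
the multiplication operators. [cite: Balaban1984PropagatorsII, (2.36) p.229] -/
theorem partitionSq_mulOp {D : Type*} [Fintype D] (h : D → S → ℝ) (h236 : ∀ y, ∑ i, h i y ^ 2 = 1) :
    PartitionSq (fun i => mulOp (h i)) := by
  unfold PartitionSq
  refine LinearMap.ext fun μ => funext fun y => ?_
  simp only [LinearMap.coe_sum, Finset.sum_apply, Module.End.mul_apply, mulOp_apply, Module.End.one_apply]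
  calc ∑ i, h i y * (h i y * μ y) = (∑ i, h i y ^ 2) * μ y := by
        rw [Finset.sum_mul]; refine Finset.sum_congr rfl fun _ _ => by ring
    _ = μ y := by rw [h236, one_mul]

/-- **The line-2 term is a kernel operator**: [h, X]·C·h = K_w(`line2Ker w h X C`). [cite: Balaban1984PropagatorsII, (2.82) line 2 p.237] -/
theorem line2_operator_eq (w h : S → ℝ) (X C : S → S → ℝ) :
    comm (mulOp h) (kerOp w X) * kerOp w C * mulOp h = kerOp w (line2Ker w h X C) := by
  rw [comm_mulOp_kerOp, kerOp_mul_kerOp, kerOp_mul_mulOp]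
  rfl

end Kernels

/-! ## §3. LINE 2 of (2.82): «An estimate of the terms with the commutator is even simpler and gives a factor O(M⁻¹)» -/

section Estimate

/-- THE LEVER: t·e^{−βt} ≤ 1/(eβ) for β > 0 and every real t (from x + 1 ≤ eˣ at x = βt − 1). [folklore] -/
theorem mul_exp_neg_le {β : ℝ} (hβ : 0 < β) (t : ℝ) : t * Real.exp (-(β * t)) ≤ 1 / (Real.exp 1 * β) := by
  have he : 0 < Real.exp 1 := Real.exp_pos 1
  have h1 : β * t ≤ Real.exp (β * t) / Real.exp 1 := by
    have h := Real.add_one_le_exp (β * t - 1)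
    rw [Real.exp_sub] at h
    linarith
  have key : β * t * Real.exp 1 ≤ Real.exp (β * t) := (le_div_iff₀ he).mp h1
  have hfac : t * Real.exp (-(β * t)) = β * t * Real.exp 1 * (Real.exp (-(β * t)) / (Real.exp 1 * β)) := by
    field_simp
  rw [hfac]
  calc β * t * Real.exp 1 * (Real.exp (-(β * t)) / (Real.exp 1 * β))
      ≤ Real.exp (β * t) * (Real.exp (-(β * t)) / (Real.exp 1 * β)) :=
        mul_le_mul_of_nonneg_right key (by positivity)
    _ = 1 / (Real.exp 1 * β) := by
        rw [← mul_div_assoc, ← Real.exp_add, add_neg_cancel, Real.exp_zero]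

variable {g : B6.Geometry}

/-- **LINE 2 OF (2.82), ONE TERM, KERNEL BOUND WITH THE FACTOR M⁻¹** (p. 238, verbatim: *"An estimate of the terms
with the commutator is even simpler and gives a factor O(M⁻¹)."*).  For y, y′ ∈ 𝔅 and the term [h_□, X_□]C_□h_□ of
line 2 (X_□ = □Q′G′(□̃)²Q′*□ with kernel `X`; C_□ with kernel `C`, vanishing off S′ = 𝔅 ∩ □ in its first argument;
h = h_□; w = the (2.69) weights): if  |w(y″)X(y,y″)| ≤ A_X e^{−aδ₀d(y,y″)}  (the kernel of Q′G′(□̃)²Q′* has *"an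
exponential decay … with the decay rate δ₀"*, p. 237, in an admissible choice of powers, weight included),
|C(y″,y′)| ≤ A_C e^{−δ₁ρ(y″)} on S′ with d(y″,y′) ≤ ρ(y″)  ((2.81) and the straight contour, as in `…B6Ineq283`),
|h(y) − h(y″)| ≤ (s/M)·d(y,y″)  (∂h_□ = O(M⁻¹): the functions h of (1.118) [B5] rescaled to the cube scale, (2.36))
and |h(y′)| ≤ 1, then for every split δ₁ + σδ₀ + bδ₀ ≤ aδ₀ with b > 0 and (2.61) at α = σ with constant c:
|([h_□, X_□]C_□h_□)(y, y′)| ≤ (s/M) · (A_X A_C c /(e·bδ₀)) · e^{−δ₁d(y,y′)}.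
(2.54) moves δ₁ onto d(y, y′), σδ₀ is summed by (2.61), and bδ₀ pays for the factor d(y, y″) through t e^{−βt} ≤ 1/(eβ).
[cite: Balaban1984PropagatorsII, (2.82) line 2 p.237 + p.238] -/
theorem line2Ker_abs_le (htri : B6RandomWalk.Triangle254 g) (hd : ∀ a b : g.Site, 0 ≤ g.dist a b)
    {δ₀ δ₁ σ b a c s AX AC : ℝ} (hδ₀ : 0 < δ₀) (hδ₁ : 0 ≤ δ₁) (hb : 0 < b)
    (hsplit : δ₁ + σ * δ₀ + b * δ₀ ≤ a * δ₀) (h261 : B6Lemma21Repaired.Ineq261With c g δ₀ σ)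
    (hs : 0 ≤ s) (hM : 0 < g.M) (hAC : 0 ≤ AC)
    {w h : g.Site → ℝ} {X C : g.Site → g.Site → ℝ} {S' : Finset g.Site} {ρ : g.Site → ℝ} {y y' : g.Site}
    (hX : ∀ y'', |w y'' * X y y''| ≤ AX * Real.exp (-(a * δ₀ * g.dist y y'')))
    (hC : ∀ y'' ∈ S', |C y'' y'| ≤ AC * Real.exp (-(δ₁ * ρ y'')))
    (hC0 : ∀ y'', y'' ∉ S' → C y'' y' = 0)
    (hρ : ∀ y'' ∈ S', g.dist y'' y' ≤ ρ y'')
    (hLip : ∀ y'', |h y - h y''| ≤ s / g.M * g.dist y y'')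
    (hh1 : |h y'| ≤ 1) :
    |line2Ker w h X C y y'| ≤
      s / g.M * (AX * AC * c / (Real.exp 1 * (b * δ₀))) * Real.exp (-(δ₁ * g.dist y y')) := by
  have hsM : 0 ≤ s / g.M := div_nonneg hs hM.le
  have hbδ : 0 < b * δ₀ := mul_pos hb hδ₀
  have hAX0 : 0 ≤ AX := (mul_nonneg_iff_of_pos_right (Real.exp_pos _)).mp ((abs_nonneg _).trans (hX y))
  -- the constant in front of the pointwise bound
  set K : ℝ := s / g.M * AX * AC * (1 / (Real.exp 1 * (b * δ₀))) with hK
  have hK0 : 0 ≤ K := mul_nonneg (mul_nonneg (mul_nonneg hsM hAX0) hAC) (by positivity)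
  -- Step 1: restrict the y″-sum to S′ (C(y″, y′) = 0 off S′)
  have hsum_eq : compKer w (commKer h X) C y y' = ∑ y'' ∈ S', w y'' * commKer h X y y'' * C y'' y' := by
    unfold compKer
    exact (Finset.sum_subset (Finset.subset_univ S') fun y'' _ hy'' => by rw [hC0 y'' hy'', mul_zero]).symm
  -- Step 2: the pointwise bound on S′
  have hpt : ∀ y'' ∈ S', |w y'' * commKer h X y y'' * C y'' y'| ≤
      K * (Real.exp (-(σ * δ₀ * g.dist y y'')) * Real.exp (-(δ₁ * g.dist y y'))) := by
    intro y'' hy''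
    have e1 : w y'' * commKer h X y y'' * C y'' y' = (h y - h y'') * (w y'' * X y y'') * C y'' y' := by
      unfold commKer; ring
    rw [e1, abs_mul, abs_mul]
    set d1 := g.dist y y'' with hd1
    have hd1nn : 0 ≤ d1 := hd y y''
    have hA := hX y''
    have hB := hC y'' hy''
    have hL := hLip y''
    have hprod : |h y - h y''| * |w y'' * X y y''| * |C y'' y'| ≤
        (s / g.M * d1) * (AX * Real.exp (-(a * δ₀ * d1))) * (AC * Real.exp (-(δ₁ * ρ y''))) := by
      apply mul_le_mul (mul_le_mul hL hA (abs_nonneg _) ((abs_nonneg _).trans hL)) hB (abs_nonneg _)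
      exact mul_nonneg ((abs_nonneg _).trans hL) ((abs_nonneg _).trans hA)
    -- exponent bookkeeping: (2.54), ρ ≥ d(y″, y′), and the split of aδ₀
    have hexp : Real.exp (-(a * δ₀ * d1)) * Real.exp (-(δ₁ * ρ y'')) ≤
        Real.exp (-(b * δ₀ * d1)) * (Real.exp (-(σ * δ₀ * d1)) * Real.exp (-(δ₁ * g.dist y y'))) := by
      rw [← Real.exp_add, ← Real.exp_add, ← Real.exp_add, Real.exp_le_exp]
      have h1 : (δ₁ + σ * δ₀ + b * δ₀) * d1 ≤ a * δ₀ * d1 := mul_le_mul_of_nonneg_right hsplit hd1nn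
      have h2 : δ₁ * g.dist y y' ≤ δ₁ * (d1 + g.dist y'' y') :=
        mul_le_mul_of_nonneg_left (htri y y'' y') hδ₁
      have h3 : δ₁ * g.dist y'' y' ≤ δ₁ * ρ y'' := mul_le_mul_of_nonneg_left (hρ y'' hy'') hδ₁
      nlinarith [h1, h2, h3]
    -- the lever
    have hlev : d1 * Real.exp (-(b * δ₀ * d1)) ≤ 1 / (Real.exp 1 * (b * δ₀)) := mul_exp_neg_le hbδ d1
    have hZ : 0 ≤ Real.exp (-(σ * δ₀ * d1)) * Real.exp (-(δ₁ * g.dist y y')) := by positivity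
    have hpre : 0 ≤ s / g.M * AX * AC := mul_nonneg (mul_nonneg hsM hAX0) hAC
    calc |h y - h y''| * |w y'' * X y y''| * |C y'' y'|
        ≤ (s / g.M * d1) * (AX * Real.exp (-(a * δ₀ * d1))) * (AC * Real.exp (-(δ₁ * ρ y''))) := hprod
      _ = s / g.M * AX * AC * (d1 * (Real.exp (-(a * δ₀ * d1)) * Real.exp (-(δ₁ * ρ y'')))) := by ring
      _ ≤ s / g.M * AX * AC * (d1 * (Real.exp (-(b * δ₀ * d1)) *
            (Real.exp (-(σ * δ₀ * d1)) * Real.exp (-(δ₁ * g.dist y y'))))) :=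
          mul_le_mul_of_nonneg_left (mul_le_mul_of_nonneg_left hexp hd1nn) hpre
      _ = s / g.M * AX * AC * ((d1 * Real.exp (-(b * δ₀ * d1))) *
            (Real.exp (-(σ * δ₀ * d1)) * Real.exp (-(δ₁ * g.dist y y')))) := by ring
      _ ≤ s / g.M * AX * AC * ((1 / (Real.exp 1 * (b * δ₀))) *
            (Real.exp (-(σ * δ₀ * d1)) * Real.exp (-(δ₁ * g.dist y y')))) :=
          mul_le_mul_of_nonneg_left (mul_le_mul_of_nonneg_right hlev hZ) hpre
      _ = K * (Real.exp (-(σ * δ₀ * d1)) * Real.exp (-(δ₁ * g.dist y y'))) := by rw [hK]; ring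
  -- Step 3: sum over S′ ⊂ 𝔅 with (2.61) at the rate σ
  have hc_sum : ∑ y'' ∈ S', Real.exp (-(σ * δ₀ * g.dist y y'')) ≤ c :=
    (Finset.sum_le_sum_of_subset_of_nonneg (Finset.subset_univ S')
      (fun _ _ _ => (Real.exp_pos _).le)).trans (h261 y)
  calc |line2Ker w h X C y y'| = |compKer w (commKer h X) C y y'| * |h y'| := by
        unfold line2Ker; exact abs_mul _ _
    _ ≤ |compKer w (commKer h X) C y y'| * 1 := mul_le_mul_of_nonneg_left hh1 (abs_nonneg _)
    _ = |∑ y'' ∈ S', w y'' * commKer h X y y'' * C y'' y'| := by rw [mul_one, hsum_eq]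
    _ ≤ ∑ y'' ∈ S', |w y'' * commKer h X y y'' * C y'' y'| := Finset.abs_sum_le_sum_abs _ _
    _ ≤ ∑ y'' ∈ S', K * (Real.exp (-(σ * δ₀ * g.dist y y'')) * Real.exp (-(δ₁ * g.dist y y'))) :=
        Finset.sum_le_sum hpt
    _ = K * Real.exp (-(δ₁ * g.dist y y')) * ∑ y'' ∈ S', Real.exp (-(σ * δ₀ * g.dist y y'')) := by
        rw [Finset.mul_sum]
        exact Finset.sum_congr rfl fun _ _ => by ring
    _ ≤ K * Real.exp (-(δ₁ * g.dist y y')) * c :=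
        mul_le_mul_of_nonneg_left hc_sum (mul_nonneg hK0 (Real.exp_pos _).le)
    _ = s / g.M * (AX * AC * c / (Real.exp 1 * (b * δ₀))) * Real.exp (-(δ₁ * g.dist y y')) := by
        rw [hK]; ring

/-- INSIDE ONE CUBE THE SCALE WEIGHT IS ≤ L⁴: a cube □ connected with the L^jη-scale meets at most B^j(Λ_j) and
B^{j+1}(Λ_{j+1}) (p. 230, p. 235), so for y, y′ ∈ 𝔅 ∩ □ the scales differ by at most one and
(L^jη)⁴ ≤ L⁴·(L^{j′}η)⁴ (j ≤ j′ + 1, L ≥ 1). [cite: Balaban1984PropagatorsII, (2.70) p.235 + (2.83)/(2.85) pp.237–238] -/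
theorem len_pow_four_le (hL : 1 ≤ g.L) (hη : 0 ≤ g.eta) {y y' : g.Site} (hsc : g.scale y ≤ g.scale y' + 1) :
    g.len y ^ 4 ≤ g.L ^ 4 * g.len y' ^ 4 := by
  have hL0 : 0 ≤ g.L := zero_le_one.trans hL
  have hle : g.len y ≤ g.L * g.len y' := by
    unfold B6.Geometry.len
    calc g.L ^ g.scale y * g.eta ≤ g.L ^ (g.scale y' + 1) * g.eta :=
          mul_le_mul_of_nonneg_right (pow_le_pow_right₀ hL hsc) hη
      _ = g.L * (g.L ^ g.scale y' * g.eta) := by rw [pow_succ]; ring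
  have hnn : 0 ≤ g.len y := mul_nonneg (pow_nonneg hL0 _) hη
  calc g.len y ^ 4 ≤ (g.L * g.len y') ^ 4 := pow_le_pow_left₀ hnn hle 4
    _ = g.L ^ 4 * g.len y' ^ 4 := mul_pow _ _ _

/-- **THE (2.85) READING OF THE COMMUTATOR FAMILY**: with the printed scale factors — the weighted kernel bound of
Q′G′(□̃)²Q′* as O(1)(L^jη)⁴e^{−aδ₀d} (A_X = B_X(L^jη)⁴) and (2.81) as c₁(L^{j′}η)^{−d−4}e^{−δ₁ρ} (A_C = B_C·P(y′)/(L^{j′}η)⁴,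
P(y′) standing for the positive factor (L^{j′}η)^{−d}) — the line-2 term obeys, for y, y′ in one cube (j ≤ j′ + 1),
|([h_□, X_□]C_□h_□)(y, y′)| ≤ M⁻¹ · (s B_X B_C L⁴ c /(e·bδ₀)) · e^{−δ₁d(y,y′)} · P(y′): the shape
*"|R(y, y′)| ≤ O(M⁻¹) e^{−δ₁d(y,y′)} (L^{j′}η)^{−d}"* of (2.85) with an M-, j-, η-independent O(·).
[cite: Balaban1984PropagatorsII, (2.85) p.238] -/
theorem line2Ker_abs_le_285 (htri : B6RandomWalk.Triangle254 g) (hd : ∀ a b : g.Site, 0 ≤ g.dist a b)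
    (hL : 1 ≤ g.L) (hη : 0 < g.eta)
    {δ₀ δ₁ σ b a c s BX BC : ℝ} (hδ₀ : 0 < δ₀) (hδ₁ : 0 ≤ δ₁) (hb : 0 < b)
    (hsplit : δ₁ + σ * δ₀ + b * δ₀ ≤ a * δ₀) (h261 : B6Lemma21Repaired.Ineq261With c g δ₀ σ)
    (hs : 0 ≤ s) (hM : 0 < g.M) (hBX : 0 ≤ BX) (hBC : 0 ≤ BC) {P : g.Site → ℝ} (hP : ∀ z, 0 ≤ P z)
    {w h : g.Site → ℝ} {X C : g.Site → g.Site → ℝ} {S' : Finset g.Site} {ρ : g.Site → ℝ} {y y' : g.Site}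
    (hsc : g.scale y ≤ g.scale y' + 1)
    (hX : ∀ y'', |w y'' * X y y''| ≤ BX * g.len y ^ 4 * Real.exp (-(a * δ₀ * g.dist y y'')))
    (hC : ∀ y'' ∈ S', |C y'' y'| ≤ BC * P y' / g.len y' ^ 4 * Real.exp (-(δ₁ * ρ y'')))
    (hC0 : ∀ y'', y'' ∉ S' → C y'' y' = 0)
    (hρ : ∀ y'' ∈ S', g.dist y'' y' ≤ ρ y'')
    (hLip : ∀ y'', |h y - h y''| ≤ s / g.M * g.dist y y'')
    (hh1 : |h y'| ≤ 1) :
    |line2Ker w h X C y y'| ≤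
      1 / g.M * (s * BX * BC * g.L ^ 4 * c / (Real.exp 1 * (b * δ₀))) * Real.exp (-(δ₁ * g.dist y y')) * P y' := by
  have hL0 : 0 < g.L := zero_lt_one.trans_le hL
  have hlen : 0 < g.len y' := mul_pos (pow_pos hL0 _) hη
  have hlen4 : 0 < g.len y' ^ 4 := pow_pos hlen 4
  have hAC : 0 ≤ BC * P y' / g.len y' ^ 4 := div_nonneg (mul_nonneg hBC (hP y')) hlen4.le
  have hmain := line2Ker_abs_le htri hd hδ₀ hδ₁ hb hsplit h261 hs hM hAC hX hC hC0 hρ hLip hh1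
  have hc0 : 0 ≤ c := B6Ineq283.c_nonneg_of_ineq261With h261 y
  have hratio : BX * g.len y ^ 4 * (BC * P y' / g.len y' ^ 4) ≤ BX * BC * g.L ^ 4 * P y' := by
    have h4 := len_pow_four_le hL hη.le hsc
    rw [mul_div_assoc']
    rw [div_le_iff₀ hlen4]
    calc BX * g.len y ^ 4 * (BC * P y') ≤ BX * (g.L ^ 4 * g.len y' ^ 4) * (BC * P y') :=
          mul_le_mul_of_nonneg_right (mul_le_mul_of_nonneg_left h4 hBX) (mul_nonneg hBC (hP y'))
      _ = BX * BC * g.L ^ 4 * P y' * g.len y' ^ 4 := by ring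
  calc |line2Ker w h X C y y'|
      ≤ s / g.M * (BX * g.len y ^ 4 * (BC * P y' / g.len y' ^ 4) * c / (Real.exp 1 * (b * δ₀))) *
          Real.exp (-(δ₁ * g.dist y y')) := hmain
    _ ≤ s / g.M * (BX * BC * g.L ^ 4 * P y' * c / (Real.exp 1 * (b * δ₀))) *
          Real.exp (-(δ₁ * g.dist y y')) := by
        apply mul_le_mul_of_nonneg_right _ (Real.exp_pos _).le
        apply mul_le_mul_of_nonneg_left _ (div_nonneg hs hM.le)
        apply div_le_div_of_nonneg_right _ (by positivity)
        exact mul_le_mul_of_nonneg_right hratio hc0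
    _ = 1 / g.M * (s * BX * BC * g.L ^ 4 * c / (Real.exp 1 * (b * δ₀))) * Real.exp (-(δ₁ * g.dist y y')) *
          P y' := by ring

end Estimate

/-! ## §4. SHARPNESS: the factor M⁻¹ of the commutator line is attained -/

section Sharpness

open B6Ineq283

variable {m : ℕ} {L R : ℝ}

/-- THE RAMP WITNESS FOR h_□: on the face geometry `faceGeo m m L R m` (support points p_t = (0, t), t = 0..m, and the
two far points), h(p_t) = 1 − t/m, h(y) = 1, h(y′) = 0 — a (1/M)-Lipschitz profile with values in [0, 1], M = m, like a
rescaled partition function h_□ of (2.36) across its boundary layer of width ∼ M (in cube-scale units). [folklore] -/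
noncomputable def rampH (m : ℕ) : Fin (m + 1) ⊕ Bool → ℝ
  | .inl t => 1 - ((t : ℕ) : ℝ) / m
  | .inr false => 1
  | .inr true => 0

/-- THE WITNESS KERNEL FOR X_□ = □Q′G′(□̃)²Q′*□: exactly the admitted majorant e^{−aδ₀d(y,y″)} (A_X = 1, w = 1).
[folklore] -/
noncomputable def rampX (m : ℕ) (L R a δ₀ : ℝ) : Fin (m + 1) ⊕ Bool → Fin (m + 1) ⊕ Bool → ℝ :=
  fun y y'' => Real.exp (-(a * δ₀ * (faceGeo m m L R m).dist y y''))

/-- THE WITNESS KERNEL FOR C_□: the identity kernel (A_C = 1, ρ = 0, S′ = {y′}). [folklore] -/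
noncomputable def deltaC (m : ℕ) : Fin (m + 1) ⊕ Bool → Fin (m + 1) ⊕ Bool → ℝ :=
  fun y'' y' => if y'' = y' then 1 else 0

/-- The support point p₀ = (0, 0) (plays y′). [folklore] -/
def p0 (m : ℕ) : Fin (m + 1) := ⟨0, Nat.succ_pos m⟩

/-- The support point p₁ = (0, 1) (plays y), m ≥ 1. [folklore] -/
def p1 (hm : 1 ≤ m) : Fin (m + 1) := ⟨1, Nat.lt_succ_of_le hm⟩

/-- The index of p₁ is 1. [folklore] -/
theorem p1_val (hm : 1 ≤ m) : (((p1 hm : Fin (m + 1)) : ℕ) : ℝ) = 1 := by simp [p1]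

/-- The index of p₀ is 0. [folklore] -/
theorem p0_val : (((p0 m : Fin (m + 1)) : ℕ) : ℝ) = 0 := by simp [p0]

/-- d(p₁, p_t) = |1 − t| on the witness. [folklore] -/
theorem dist_p1_inl (hm : 1 ≤ m) (t : Fin (m + 1)) :
    (faceGeo m m L R m).dist (Sum.inl (p1 hm)) (Sum.inl t) = |1 - ((t : ℕ) : ℝ)| := by
  rw [faceGeo_dist, facePt_dist_p_p, p1_val]

/-- d(p₁, p₀) = 1 on the witness. [folklore] -/
theorem dist_p1_p0 (hm : 1 ≤ m) :
    (faceGeo m m L R m).dist (Sum.inl (p1 hm)) (Sum.inl (p0 m)) = 1 := by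
  rw [dist_p1_inl, p0_val, sub_zero, abs_one]

/-- d(p₀, p₀) = 0 on the witness. [folklore] -/
theorem dist_p0_p0 : (faceGeo m m L R m).dist (Sum.inl (p0 m)) (Sum.inl (p0 m)) = 0 := by
  rw [faceGeo_dist, facePt_dist_p_p, sub_self, abs_zero]

/-- d(p₁, y) = m on the witness (y = the far point (−m, 0)). [folklore] -/
theorem dist_p1_far (hm : 1 ≤ m) :
    (faceGeo m m L R m).dist (Sum.inl (p1 hm)) (Sum.inr false) = m := by
  have h := faceGeo_symm (m := m) (D := (m : ℝ)) (L := L) (R := R) (M := (m : ℝ)) (Sum.inl (p1 hm)) (Sum.inr false)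
  rw [h, faceGeo_dist, facePt_dist_y_p le_rfl]

/-- d(p₁, y′) = m on the witness (y′ = the far point (m, m)). [folklore] -/
theorem dist_p1_far' (hm : 1 ≤ m) :
    (faceGeo m m L R m).dist (Sum.inl (p1 hm)) (Sum.inr true) = m := by
  rw [faceGeo_dist, facePt_dist_p_y']

/-- The admitted X-majorant holds (with equality, A_X = 1, w = 1). [folklore] -/
theorem ramp_hX (a δ₀ : ℝ) (y y'' : Fin (m + 1) ⊕ Bool) :
    |(fun _ => (1 : ℝ)) y'' * rampX m L R a δ₀ y y''| ≤ 1 * Real.exp (-(a * δ₀ * (faceGeo m m L R m).dist y y'')) := by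
  simp only [rampX, one_mul]
  exact le_of_eq (abs_of_pos (Real.exp_pos _))

/-- The admitted C-majorant holds on S′ = {p₀} with A_C = 1, ρ = 0. [folklore] -/
theorem ramp_hC (δ₁ : ℝ) (y'' : Fin (m + 1) ⊕ Bool) (hy'' : y'' ∈ ({Sum.inl (p0 m)} : Finset (Fin (m + 1) ⊕ Bool))) :
    |deltaC m y'' (Sum.inl (p0 m))| ≤ 1 * Real.exp (-(δ₁ * (fun _ => (0 : ℝ)) y'')) := by
  rw [Finset.mem_singleton] at hy''
  simp [deltaC, hy'']

/-- C vanishes off S′ = {p₀} in its first argument. [folklore] -/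
theorem ramp_hC0 (y'' : Fin (m + 1) ⊕ Bool) (hy'' : y'' ∉ ({Sum.inl (p0 m)} : Finset (Fin (m + 1) ⊕ Bool))) :
    deltaC m y'' (Sum.inl (p0 m)) = 0 := by
  rw [Finset.mem_singleton] at hy''
  simp [deltaC, hy'']

/-- ρ = 0 dominates d(y″, y′) on S′ = {y′}. [folklore] -/
theorem ramp_hρ (y'' : Fin (m + 1) ⊕ Bool) (hy'' : y'' ∈ ({Sum.inl (p0 m)} : Finset (Fin (m + 1) ⊕ Bool))) :
    (faceGeo m m L R m).dist y'' (Sum.inl (p0 m)) ≤ (fun _ => (0 : ℝ)) y'' := by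
  rw [Finset.mem_singleton] at hy''
  subst hy''
  exact le_of_eq dist_p0_p0

/-- THE RAMP IS EXACTLY (1/M)-LIPSCHITZ FROM p₁ in the witness distance (s = 1, M = m). [folklore] -/
theorem ramp_hLip (hm : 1 ≤ m) (y'' : Fin (m + 1) ⊕ Bool) :
    |rampH m (Sum.inl (p1 hm)) - rampH m y''| ≤
      1 / (faceGeo m m L R m).M * (faceGeo m m L R m).dist (Sum.inl (p1 hm)) y'' := by
  have hm0 : (0 : ℝ) < m := by exact_mod_cast hm
  have hm1 : (1 : ℝ) ≤ m := by exact_mod_cast hm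
  have hM : (faceGeo m (m : ℝ) L R m).M = m := rfl
  rw [hM]
  rcases y'' with t | b
  · rw [dist_p1_inl hm t]
    simp only [rampH, p1_val]
    rw [show (1 : ℝ) - 1 / m - (1 - ((t : ℕ) : ℝ) / m) = (1 / m) * (((t : ℕ) : ℝ) - 1) by ring, abs_mul,
      abs_of_pos (by positivity : (0 : ℝ) < 1 / m), abs_sub_comm]
  · rcases b with _ | _
    · rw [dist_p1_far hm]
      simp only [rampH, p1_val]
      rw [show (1 : ℝ) - 1 / m - 1 = -(1 / m) by ring, abs_neg, abs_of_pos (by positivity : (0 : ℝ) < 1 / m)]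
      rw [one_div_mul_cancel hm0.ne']
      exact (div_le_one hm0).mpr hm1
    · rw [dist_p1_far' hm]
      simp only [rampH, p1_val, sub_zero]
      rw [one_div_mul_cancel hm0.ne', abs_of_nonneg (by rw [sub_nonneg]; exact (div_le_one hm0).mpr hm1)]
      linarith [show (0 : ℝ) < 1 / m by positivity]

/-- |h(y′)| ≤ 1 at y′ = p₀ (h(p₀) = 1). [folklore] -/
theorem ramp_hh1 : |rampH m (Sum.inl (p0 m))| ≤ 1 := by
  simp [rampH, p0]

/-- The X-witness at (p₁, p₀): e^{−aδ₀} (d(p₁, p₀) = 1). [folklore] -/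
theorem rampX_p1_p0 (hm : 1 ≤ m) (a δ₀ : ℝ) :
    rampX m L R a δ₀ (Sum.inl (p1 hm)) (Sum.inl (p0 m)) = Real.exp (-(a * δ₀)) := by
  show Real.exp (-(a * δ₀ * (faceGeo m m L R m).dist (Sum.inl (p1 hm)) (Sum.inl (p0 m)))) = _
  rw [dist_p1_p0 hm, mul_one]

/-- **THE VALUE OF THE LINE-2 KERNEL ON THE WITNESS**: ([h, X]·C·h)(p₁, p₀) = −e^{−aδ₀}/M (M = m). [folklore] -/
theorem ramp_line2Ker_eq (hm : 1 ≤ m) (a δ₀ : ℝ) :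
    line2Ker (fun _ => (1 : ℝ)) (rampH m) (rampX m L R a δ₀) (deltaC m) (Sum.inl (p1 hm)) (Sum.inl (p0 m)) =
      -(Real.exp (-(a * δ₀)) / m) := by
  unfold line2Ker compKer commKer deltaC
  simp only [mul_ite, mul_one, mul_zero, Finset.sum_ite_eq', Finset.mem_univ, if_true, one_mul]
  rw [rampX_p1_p0 hm]
  simp only [rampH, p1_val, p0_val, zero_div, sub_zero, mul_one]
  ring

/-- **THE FACTOR M⁻¹ IS ATTAINED** (sharpness of the printed *"gives a factor O(M⁻¹)"*): on the ramp witness, with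
all data constants (s, A_X, A_C) = (1, 1, 1) independent of M, |([h, X]·C·h)(p₁, p₀)| = e^{−aδ₀} · M⁻¹ exactly.
[folklore] -/
theorem commutator_factor_attained (hm : 1 ≤ m) (a δ₀ : ℝ) :
    |line2Ker (fun _ => (1 : ℝ)) (rampH m) (rampX m L R a δ₀) (deltaC m) (Sum.inl (p1 hm)) (Sum.inl (p0 m))| =
      Real.exp (-(a * δ₀)) * (1 / (faceGeo m m L R m).M) := by
  have hm0 : (0 : ℝ) < m := by exact_mod_cast hm
  show _ = Real.exp (-(a * δ₀)) * (1 / (m : ℝ))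
  rw [ramp_line2Ker_eq hm, abs_neg, abs_of_pos (div_pos (Real.exp_pos _) hm0)]
  ring

/-- **ALL HYPOTHESES OF `line2Ker_abs_le` HOLD ON THE WITNESS with M-independent constants**: (2.54), d ≥ 0, the
split data, (2.61) at rate σ with c = 2 + c₀(σ) (`faceGeo_ineq261With`), s = 1, M = m > 0, A_C = 1 ≥ 0, and the six
kernel/profile hypotheses; hence the theorem's bound reads |…(p₁, p₀)| ≤ M⁻¹·((2 + c₀(σ))/(e·bδ₀))·e^{−δ₁}, while the
value is e^{−aδ₀}·M⁻¹ (`commutator_factor_attained`): the M-dependence M⁻¹ of the printed estimate is exact. [folklore] -/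
theorem ramp_bound_and_value (hm : 1 ≤ m) {δ₀ δ₁ σ b a : ℝ} (hδ₀ : 0 < δ₀) (hδ₁ : 0 ≤ δ₁) (hσ : 0 < σ)
    (hb : 0 < b) (hsplit : δ₁ + σ * δ₀ + b * δ₀ ≤ a * δ₀) :
    |line2Ker (fun _ => (1 : ℝ)) (rampH m) (rampX m L R a δ₀) (deltaC m) (Sum.inl (p1 hm)) (Sum.inl (p0 m))| ≤
        1 / (faceGeo m m L R m).M * (1 * 1 * (2 + B6.c0 δ₀ σ) / (Real.exp 1 * (b * δ₀))) * Real.exp (-(δ₁ * 1)) ∧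
      |line2Ker (fun _ => (1 : ℝ)) (rampH m) (rampX m L R a δ₀) (deltaC m) (Sum.inl (p1 hm)) (Sum.inl (p0 m))| =
        Real.exp (-(a * δ₀)) * (1 / (faceGeo m m L R m).M) := by
  refine ⟨?_, commutator_factor_attained hm a δ₀⟩
  have hM : (0 : ℝ) < (faceGeo m (m : ℝ) L R m).M := by
    show (0 : ℝ) < (m : ℝ); exact_mod_cast hm
  have h := line2Ker_abs_le (g := faceGeo m m L R m) faceGeo_triangle faceGeo_dist_nonneg hδ₀ hδ₁ hb hsplit
    (faceGeo_ineq261With (mul_pos hσ hδ₀) le_rfl) zero_le_one hM zero_le_one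
    (S' := ({Sum.inl (p0 m)} : Finset (Fin (m + 1) ⊕ Bool))) (ρ := fun _ => (0 : ℝ))
    (ramp_hX a δ₀ (Sum.inl (p1 hm))) (ramp_hC δ₁) ramp_hC0 ramp_hρ (ramp_hLip hm) ramp_hh1
  rwa [dist_p1_p0 hm] at h

/-- **NO o(M⁻¹)**: a bound of the shape |…(y, y′)| ≤ (κ/M)·e^{−δ₁d(y,y′)} valid on the witness forces κ ≥ e^{δ₁−aδ₀},
uniformly in M = m ≥ 1 — the O(M⁻¹) of p. 238 is the true order of the commutator terms. [folklore] -/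
theorem ramp_constant_lower (hm : 1 ≤ m) {a δ₀ δ₁ κ : ℝ}
    (hκ : |line2Ker (fun _ => (1 : ℝ)) (rampH m) (rampX m L R a δ₀) (deltaC m) (Sum.inl (p1 hm)) (Sum.inl (p0 m))|
      ≤ κ / (faceGeo m m L R m).M *
        Real.exp (-(δ₁ * (faceGeo m m L R m).dist (Sum.inl (p1 hm)) (Sum.inl (p0 m))))) :
    Real.exp (δ₁ - a * δ₀) ≤ κ := by
  have hm0 : (0 : ℝ) < m := by exact_mod_cast hm
  rw [commutator_factor_attained hm, dist_p1_p0 hm, mul_one] at hκ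
  change Real.exp (-(a * δ₀)) * (1 / (m : ℝ)) ≤ κ / (m : ℝ) * Real.exp (-δ₁) at hκ
  -- e^{−aδ₀}/m ≤ (κ/m) e^{−δ₁}
  have h1 : Real.exp (-(a * δ₀)) ≤ κ * Real.exp (-δ₁) := by
    have := mul_le_mul_of_nonneg_left hκ hm0.le
    rw [show (m : ℝ) * (Real.exp (-(a * δ₀)) * (1 / m)) = Real.exp (-(a * δ₀)) by field_simp,
      show (m : ℝ) * (κ / m * Real.exp (-δ₁)) = κ * Real.exp (-δ₁) by field_simp] at this
    exact this
  have h2 : Real.exp (δ₁ - a * δ₀) = Real.exp (-(a * δ₀)) * Real.exp δ₁ := by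
    rw [← Real.exp_add]; ring_nf
  rw [h2]
  calc Real.exp (-(a * δ₀)) * Real.exp δ₁ ≤ κ * Real.exp (-δ₁) * Real.exp δ₁ :=
        mul_le_mul_of_nonneg_right h1 (Real.exp_pos _).le
    _ = κ := by rw [mul_assoc, ← Real.exp_add, neg_add_cancel, Real.exp_zero, mul_one]

end Sharpness

end Literature.MathematicalPhysics.QuantumFieldTheory.Balaban1983to89.B6Expansion282
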